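import Mathlib
import HarnessLib
import Literature.MathematicalPhysics.QuantumLattice.HubbardUVCovarianceCTFrameDefect
import Summits.HubbardSuperconductivity.HubbardSuperconductivity.Theorems.KLProgrammeKLRegimeVolumeLimitFlowFramesCoeffNorm
import Summits.HubbardSuperconductivity.HubbardSuperconductivity.Theorems.KLProgrammeKLRegimeEngineScaleZeroDecay
import Summits.HubbardSuperconductivity.HubbardSuperconductivity.Theorems.KLProgrammeDispersionFlowEnvelope

/-!
# Route A, bracket (A4) BY NAME: the frame defect `Sᵀ(C^{K}_{>Λ} − C^{K′}_{>Λ})S` between the flow frames of TWO VOLUMES, `K = K_n^{(L,M)}`,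
# `K′ = K_n^{(L′,M′)}`, has row/column sums and entry sup `C(β, n, Λ, grid)/L`, FROM THE REV-2 TOWER `klPredsV17F2`

Cell gate-hubbard-kl, seat hubbard-kl-k3c5-p3 (g8; VL lane).  Item of record stmt-HubbardSuperconductivity-20440 `KLRegimeVolumeLimitV17F2` (stub
`stub_vl_nestedFramed`, ROUTE A of k3c4-p1's VL-STUB-ROUTE-A.md: (A1) p530332, (A2) p532315/p533120, (A5) k3c5-p2 — this file is (A4); (A3), the inductive
tower comparison, consumes it at every scale `n ≥ 1` on the fine grid) and the (E3f-F) STEP(n) `hstep n` of the engine child 20437 (r2d-p1's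
`…EngineTwoLegStepHistDoors`).  The covariance data of the near-identity step `GrassmannNearIdentityStep.sum_norm_kernel_effAction_sub_self_le_of_gramBounded`
for the symbol-difference defect (`hrow`, `hcol`, entry sup `s`; the Gram constant is `κ + κ′` by `IsGramBoundedR.sub`) are assembled from:
the two-frame Literature layer `HubbardUVSymbolFrameDifferences` / `HubbardUVSymbolCTFrameDifferences` / `HubbardUVCovarianceCTFrameDefect` (k3c5-p3 g8),
the all-order two-volume frame comparability `…VolumeLimitFlowFramesJets` (p534357), and `FrameOK ⟹ UVLineBound μ K 7` (`…EngineScaleZeroDecay`, k3c4-p2).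

* §1 `lineDiff_of_coeffNorm_le` — the band-difference datum of the Literature layer for ANY two frames from `coeffNorm j (A ⊖ B) ≤ εⱼ` (`j ≤ 2`);
* §2 `uvLineBound_klFlowFrameU_of_towerV17F2` — `UVLineBound μ K_n^{(L,M)} 7` for every `n ≤ nScales β + 1` from the tower (`K_0 = 0` by `uvLineBound_zero_of_klWindowC`;
  `K_{k+1}` by `frameOK_klFlowFrameU_succ` with (I-F jets)/(I-F geometry) of the renormalisation slot);
* §3 `lineDiff_klFlowFrameU_of_towerV17F2` — the datum for `K_n^{(L,M)}, K_n^{(L′,M′)}` with `εⱼ = c_j(n)/L`, `c_j(n) = Σ_{m<n} 4(2d_m+1)(1+4d_m)^j·Q.CL β m`;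
* §4 **`rowSum_frameDefect_le_of_towerV17F2`**, **`colSum_frameDefect_le_of_towerV17F2`**, **`norm_frameDefect_apply_le_of_towerV17F2`** — the defect on ANY
  grid `(L₂, Mc, Ng)` (`2 ≤ Mc`, `2Mc ≤ Ng`, `0 < Λ`, every `s₀ > 0`): the Literature bounds with `D = 7` and `εⱼ = c_j(n)/L` — every term carries a
  factor `c_j(n)/L`, i.e. the bracket is `O_{β,n,Λ}(1/L)` as Route A's rate bookkeeping requires;
* §5 history level (r2d-p1's `hist`/`hC`/`hrates` binders, inside `hstep n`): `lineDiff_klFlowFrameU_of_rates_hist`, **`rowSum_frameDefect_le_of_rates_hist`**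
  (`εⱼ = (Σ_{m<n} 4(2d_m+1)(1+4d_m)^j a_m)/L₁`, both frames' `UVLineBound` as hypotheses);
* §6 one volume, CONSECUTIVE frames: `coeffNorm_fsub_klFlowFrameU_succ_le_of_towerV17F2` (`coeffNorm r (K_n ⊖ K_{n+1}) ≤ 4(2d_n+1)(1+4d_n)^r·R.cr|U|Λ_n²/e₀`) —
  with §1 and the Literature layer, the pinned-currency frame-SHIFT covariance defect of the engine's cross-frame steps.

Everything is proved; no definition; nothing is asserted about the model.
-/

noncomputable section

namespace Summit.HubbardSuperconductivity.HubbardSuperconductivity.Theorems.TwoPointAssembly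

set_option linter.dupNamespace false -- summit = problem name (single-conjunct summit), D-0017

open Real Finset Filter Topology Literature.MathematicalPhysics.QuantumLattice Literature.Probability.LatticeModels
open Summit.HubbardSuperconductivity.HubbardSuperconductivity.Theorems.DispersionFlow
open Summit.HubbardSuperconductivity.HubbardSuperconductivity.Theorems.KLRegimeSplit
open Summit.HubbardSuperconductivity.HubbardSuperconductivity.Theorems.KLProgrammeLegKernels
open Summit.HubbardSuperconductivity.HubbardSuperconductivity.Theorems.ScaleZeroDecay
open Literature.MathematicalPhysics.QuantumLattice.FermiRG
open Summit.HubbardSuperconductivity.HubbardSuperconductivity.Theorems.EngineV8 (contDiff_frameLevel)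

/-! ## §1 The band-difference datum of two frames from their coefficient weights -/

/-- **The band-difference datum from `coeffNorm`**: if `coeffNorm j (A ⊖ B) ≤ εⱼ` for `j = 0, 1, 2` then along every lattice line `t ↦ A(p + t e_l) − B(p + t e_l)`
is `C²` with value, first and second derivative bounded by `ε₀, ε₁, ε₂` (witnesses `deriv` and `deriv ∘ deriv`; `…FlowFramesJets.norm_iteratedDeriv_eval_sub_line_le_coeffNorm`). -/
theorem lineDiff_of_coeffNorm_le (A B : TrigPolyC4v) {ε₀ ε₁ ε₂ : ℝ} (h0 : (fsub A B).coeffNorm 0 ≤ ε₀) (h1 : (fsub A B).coeffNorm 1 ≤ ε₁)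
    (h2 : (fsub A B).coeffNorm 2 ≤ ε₂) :
    ∀ (p : Fin 2 → ℝ) (l : Fin 2), ∃ d' d'' : ℝ → ℝ,
      (∀ t, HasDerivAt (fun t => A.eval (p + t • Pi.single l 1) - B.eval (p + t • Pi.single l 1)) (d' t) t) ∧
        (∀ t, HasDerivAt d' (d'' t) t) ∧
          ∀ t, |A.eval (p + t • Pi.single l 1) - B.eval (p + t • Pi.single l 1)| ≤ ε₀ ∧ |d' t| ≤ ε₁ ∧ |d'' t| ≤ ε₂ := by
  intro p l
  set f : ℝ → ℝ := fun t => A.eval (p + t • Pi.single l 1) - B.eval (p + t • Pi.single l 1) with hf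
  have hfe : f = fun t => (fsub A B).eval (p + t • Pi.single l 1) := by
    funext t; rw [hf, eval_fsub]
  have hC : ContDiff ℝ 2 f := by rw [hfe]; exact contDiff_eval_line (fsub A B) p l
  have hg1 : ContDiff ℝ 1 (deriv f) := by
    have h2 : ContDiff ℝ (1 + 1) f := by rw [show ((1 : WithTop ℕ∞) + 1) = 2 by norm_num]; exact hC
    exact (contDiff_succ_iff_deriv.1 h2).2.2
  refine ⟨deriv f, deriv (deriv f), fun t => (hC.differentiable (by norm_num) t).hasDerivAt,
    fun t => (hg1.differentiable one_ne_zero t).hasDerivAt, fun t => ⟨?_, ?_, ?_⟩⟩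
  · have h := norm_iteratedDeriv_eval_sub_line_le_coeffNorm A B p l 0 t
    rw [iteratedDeriv_zero, Real.norm_eq_abs] at h
    exact h.trans h0
  · have h := norm_iteratedDeriv_eval_sub_line_le_coeffNorm A B p l 1 t
    rw [iteratedDeriv_one, Real.norm_eq_abs] at h
    exact h.trans h1
  · have h := norm_iteratedDeriv_eval_sub_line_le_coeffNorm A B p l 2 t
    rw [iteratedDeriv_succ, iteratedDeriv_one, Real.norm_eq_abs] at h
    exact h.trans h2

/-! ## §2 The flow frames are admissible lattice-line bands (`UVLineBound μ K_n 7`) from the tower -/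

section Tower

variable {G : GeoConsts} {P : SplitConsts} {Q : EngConsts} {R : RenConsts} {β U μ : ℝ} {K₀ : TrigPolyC4v} {Lstar : ℕ} {Mstar : ℕ → ℕ}

/-- **The bare band is an admissible lattice-line band on `klWindowC`**: `UVLineBound μ 0 7` (the geometric half of `klFrameOK_zero_of_mem`, kept local so that
this file stays out of the route file's import cone: fs-1's closed-form FST II constants weakened to `(7, 3/80, 1/2, 3/200)`, then the unit-speed line as in
`uvLineBound_of_frameOK`). -/
theorem uvLineBound_zero_of_klWindowC {μ : ℝ} (hμ : μ ∈ klWindowC) : UVLineBound μ 0 7 := by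
  have hμ' := hμ
  simp only [klWindowC, Set.mem_Icc] at hμ'
  obtain ⟨hμ₁, hμ₂⟩ := hμ'
  have h83 : -8 / 3 < μ := by linarith
  have h0 : μ < 0 := by linarith
  have hG0 := Summit.HubbardSuperconductivity.HubbardSuperconductivity.Theorems.klfs_geomConstants h83 h0
  have hfl : frameLevel μ 0 = fun q : Momentum => squareDispersion 1 0 q - μ := by funext q; simp [frameLevel]
  have hG : GeomConstants (frameLevel μ 0) 7 (3 / 80) (1 / 2) (3 / 200) := by
    rw [hfl]
    refine GeomConstants.weaken hG0 ?_ ?_ ?_ ?_ (by norm_num) (by norm_num) (by norm_num)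
    · rw [abs_of_neg h0]; linarith
    · linarith
    · apply Real.le_sqrt_of_sq_le
      nlinarith [mul_nonneg (show (0 : ℝ) ≤ μ + 1.05 by linarith) (show (0 : ℝ) ≤ -0.15 - μ by linarith)]
    · linarith
  intro p l
  set f : EuclideanSpace ℝ (Fin 2) → ℝ := frameLevel μ 0 with hf
  set v : EuclideanSpace ℝ (Fin 2) := EuclideanSpace.single l (1 : ℝ) with hv
  set Φ : ℝ →L[ℝ] EuclideanSpace ℝ (Fin 2) := ContinuousLinearMap.toSpanSingleton ℝ v with hΦ
  set P : EuclideanSpace ℝ (Fin 2) := WithLp.toLp 2 p with hP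
  have hC : ContDiff ℝ 2 f := contDiff_frameLevel μ 0
  have hΦnorm : ‖Φ‖ ≤ 1 := by
    rw [hΦ, ContinuousLinearMap.norm_toSpanSingleton, hv, PiLp.norm_single, norm_one]
  set h : EuclideanSpace ℝ (Fin 2) → ℝ := fun y => f (y + P) with hh
  have hhC : ContDiff ℝ 2 h := hC.comp (contDiff_id.add contDiff_const)
  set g : ℝ → ℝ := h ∘ Φ with hg
  have hgC : ContDiff ℝ 2 g := hhC.comp Φ.contDiff
  have hline : ctLine μ 0 p l = g := by
    funext t
    rw [ctLine_eq_frameLevel_line, hg, Function.comp_apply, hh]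
  have hbound : ∀ (k : ℕ), 1 ≤ k → k ≤ 2 → ∀ t : ℝ, ‖iteratedFDeriv ℝ k g t‖ ≤ 7 := by
    intro k hk1 hk2 t
    rw [hg, ContinuousLinearMap.iteratedFDeriv_comp_right Φ hhC t (i := k) (by exact_mod_cast hk2)]
    refine (ContinuousMultilinearMap.norm_compContinuousLinearMap_le _ _).trans ?_
    have h1 : ‖iteratedFDeriv ℝ k h (Φ t)‖ ≤ 7 := by
      rw [hh, iteratedFDeriv_comp_add_right k P (Φ t)]
      exact hG.norm_iteratedFDeriv_le _ k hk2
    have h2 : ∏ _i : Fin k, ‖Φ‖ ≤ 1 := prod_le_one (fun _ _ => norm_nonneg _) fun _ _ => hΦnorm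
    calc ‖iteratedFDeriv ℝ k h (Φ t)‖ * ∏ _i : Fin k, ‖Φ‖ ≤ 7 * 1 := mul_le_mul h1 h2 (by positivity) (by norm_num)
      _ = 7 := mul_one _
  have hg1 : ContDiff ℝ 1 (deriv g) := by
    have h2 : ContDiff ℝ (1 + 1) g := by rw [show ((1 : WithTop ℕ∞) + 1) = 2 by norm_num]; exact hgC
    exact (contDiff_succ_iff_deriv.1 h2).2.2
  refine ⟨deriv g, deriv (deriv g), fun t => ?_, fun t => ?_, fun t => ⟨?_, ?_⟩⟩
  · rw [hline]; exact (hgC.differentiable (by norm_num) t).hasDerivAt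
  · exact (hg1.differentiable one_ne_zero t).hasDerivAt
  · have := hbound 1 le_rfl (by norm_num) t
    rwa [norm_iteratedFDeriv_eq_norm_iteratedDeriv, iteratedDeriv_one, Real.norm_eq_abs] at this
  · have := hbound 2 (by norm_num) le_rfl t
    rwa [norm_iteratedFDeriv_eq_norm_iteratedDeriv, iteratedDeriv_succ, iteratedDeriv_one, Real.norm_eq_abs] at this

/-- **`UVLineBound μ K_n^{(L,M)} 7` for every flow frame of the tower** (`n ≤ nScales β + 1`, `Lstar ≤ L`, `Mstar L ≤ M`, `μ ∈ klWindowC`):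
`K_0 = 0` by `uvLineBound_zero_of_klWindowC`; `K_{k+1}` is admissible by (I-F jets) at `m ≤ k` and (I-F geometry) at `k` of the renormalisation slot
(`frameOK_klFlowFrameU_succ`); then `uvLineBound_of_frameOK`. -/
theorem uvLineBound_klFlowFrameU_of_towerV17F2 (hμ : μ ∈ klWindowC) (hT : TowerP klPredsV17F2 G P Q R β U μ K₀ Lstar Mstar)
    {L : ℕ} [NeZero L] (hL : Lstar ≤ L) {M : ℕ} [NeZero M] (hM : Mstar L ≤ M) {n : ℕ} (hn : n ≤ nScales β + 1) :
    UVLineBound μ (klFlowFrameU L M β U μ n) 7 := by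
  rcases n with _ | k
  · rw [klFlowFrameU_zero]
    exact uvLineBound_zero_of_klWindowC hμ
  · have hTL := hT L M hL hM
    have hren : ∀ m ≤ k, RenormFlowAtV17F L M β U μ R m := fun m hm => (hTL.1 m (by omega)).1
    exact uvLineBound_of_frameOK (frameOK_klFlowFrameU_succ (fun m hm => (hren m hm).2.1) (hren k le_rfl).2.2)

/-! ## §3 The band-difference datum of the flow frames of two volumes, `εⱼ = c_j(n)/L` -/

/-- **The flow frames of two volumes as a band-difference datum**: under the tower, for `Lstar ≤ L ≤ L′` (thresholds as in `…FlowFramesJets`), `n ≤ nScales β + 1`: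
along every lattice line `K_n^{(L,M)} − K_n^{(L′,M′)}` is `C²` with value / first / second derivative `≤ c_j(n)/L`,
`c_j(n) = Σ_{m<n} 4(2d_m+1)(1+4d_m)^j·Q.CL β m` (`coeffNorm_fsub_klFlowFrameU_le_of_towerV17F2` + §1). -/
theorem lineDiff_klFlowFrameU_of_towerV17F2 (hμ : μ ∈ klWindowC) (hT : TowerP klPredsV17F2 G P Q R β U μ K₀ Lstar Mstar)
    {L : ℕ} [NeZero L] (hL : Lstar ≤ L) {L' : ℕ} [NeZero L'] (hLL' : L ≤ L')
    {M : ℕ} [NeZero M] (hM₁ : Mstar L ≤ M) (hM₂ : Q.M0 β L ≤ M) {M' : ℕ} [NeZero M'] (hM'₁ : Mstar L' ≤ M') (hM'₂ : Q.M0 β L' ≤ M')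
    {n : ℕ} (hn : n ≤ nScales β + 1) :
    ∀ (p : Fin 2 → ℝ) (l : Fin 2), ∃ d' d'' : ℝ → ℝ,
      (∀ t, HasDerivAt (fun t => (klFlowFrameU L M β U μ n).eval (p + t • Pi.single l 1) -
        (klFlowFrameU L' M' β U μ n).eval (p + t • Pi.single l 1)) (d' t) t) ∧
        (∀ t, HasDerivAt d' (d'' t) t) ∧
          ∀ t, |(klFlowFrameU L M β U μ n).eval (p + t • Pi.single l 1) - (klFlowFrameU L' M' β U μ n).eval (p + t • Pi.single l 1)| ≤
              (∑ m ∈ range n, 4 * (2 * klFlowDeg m + 1) * (1 + 4 * klFlowDeg m) ^ 0 * Q.CL β m) / L ∧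
            |d' t| ≤ (∑ m ∈ range n, 4 * (2 * klFlowDeg m + 1) * (1 + 4 * klFlowDeg m) ^ 1 * Q.CL β m) / L ∧
            |d'' t| ≤ (∑ m ∈ range n, 4 * (2 * klFlowDeg m + 1) * (1 + 4 * klFlowDeg m) ^ 2 * Q.CL β m) / L :=
  lineDiff_of_coeffNorm_le _ _ (coeffNorm_fsub_klFlowFrameU_le_of_towerV17F2 hμ hT hL hLL' hM₁ hM₂ hM'₁ hM'₂ hn 0)
    (coeffNorm_fsub_klFlowFrameU_le_of_towerV17F2 hμ hT hL hLL' hM₁ hM₂ hM'₁ hM'₂ hn 1)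
    (coeffNorm_fsub_klFlowFrameU_le_of_towerV17F2 hμ hT hL hLL' hM₁ hM₂ hM'₁ hM'₂ hn 2)

/-- The (E3f-F) rates of the tower are nonnegative (they bound an absolute value), hence so is every `c_j(n)/L`. -/
theorem sum_klFlowDeg_rate_div_nonneg (hμ : μ ∈ klWindowC) (hT : TowerP klPredsV17F2 G P Q R β U μ K₀ Lstar Mstar)
    {L : ℕ} [NeZero L] (hL : Lstar ≤ L) {M : ℕ} [NeZero M] (hM₁ : Mstar L ≤ M) (hM₂ : Q.M0 β L ≤ M) {n : ℕ} (hn : n ≤ nScales β + 1) (j : ℕ) :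
    0 ≤ (∑ m ∈ range n, 4 * (2 * klFlowDeg m + 1) * (1 + 4 * klFlowDeg m) ^ j * Q.CL β m) / L := by
  have h := coeffNorm_fsub_klFlowFrameU_le_of_towerV17F2 hμ hT hL le_rfl hM₁ hM₂ hM₁ hM₂ hn j
  exact (TrigPolyC4v.coeffNorm_nonneg _ _).trans h

/-! ## §4 The frame defect of two volumes on a grid: row sums, column sums, entry sup — all `O(1/L)` -/

/-- **ROW SUMS OF THE TWO-VOLUME FRAME DEFECT, FROM THE TOWER.**  Under `TowerP klPredsV17F2 …` (`μ ∈ klWindowC`, `0 < β`), for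
`Lstar ≤ L ≤ L′` with the thresholds of `…FlowFramesJets`, `n ≤ nScales β + 1`, a scale `Λ > 0`, any grid `(L₂, Mc, Ng)` with `2 ≤ Mc`, `2Mc ≤ Ng`,
and every `s₀ > 0`: every row sum of `D := Sᵀ(C^{K_n^{(L,M)}}_{>Λ} − C^{K_n^{(L′,M′)}}_{>Λ})S` is bounded by the two-frame decay constant of
`HubbardUVCovarianceCTFrameDefect.rowSum_gridSub_hubbardCovAboveCT_sub_le` at `D = 7`, `εⱼ = c_j(n)/L` — every term carries a factor `c_j(n)/L`. -/
theorem rowSum_frameDefect_le_of_towerV17F2 (hμ : μ ∈ klWindowC) (hβ : 0 < β)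
    (hT : TowerP klPredsV17F2 G P Q R β U μ K₀ Lstar Mstar)
    {L : ℕ} [NeZero L] (hL : Lstar ≤ L) {L' : ℕ} [NeZero L'] (hLL' : L ≤ L')
    {M : ℕ} [NeZero M] (hM₁ : Mstar L ≤ M) (hM₂ : Q.M0 β L ≤ M) {M' : ℕ} [NeZero M'] (hM'₁ : Mstar L' ≤ M') (hM'₂ : Q.M0 β L' ≤ M')
    {n : ℕ} (hn : n ≤ nScales β + 1) {Λ : ℝ} (hΛ : 0 < Λ)
    {L₂ Mc Ng : ℕ} [NeZero L₂] [NeZero Ng] (hMc : 2 ≤ Mc) (hMN : 2 * Mc ≤ Ng) {s₀ : ℝ} (hs₀ : 0 < s₀) (X : GridLeg (GridPoint L₂ Ng)) :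
    ∑ Y : GridLeg (GridPoint L₂ Ng),
        ‖((hubbardGridSub L₂ Mc β Ng).transpose * hubbardCovAboveCT L₂ Mc β μ 0 (klFlowFrameU L M β U μ n) Λ * hubbardGridSub L₂ Mc β Ng -
            (hubbardGridSub L₂ Mc β Ng).transpose * hubbardCovAboveCT L₂ Mc β μ 0 (klFlowFrameU L' M' β U μ n) Λ * hubbardGridSub L₂ Mc β Ng) X Y‖ ≤
      Real.sqrt ((2 + 12 / s₀) * 14 ^ 2) *
        Real.sqrt ((Ng : ℝ) ^ 1 * (L₂ : ℝ) ^ 2 *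
          ((L₂ : ℝ) ^ 2 * ((1 / (β * (L₂ : ℝ) ^ 2)) ^ 4 * (β * (L₂ : ℝ) ^ 2) ^ 2 *
              (uvMixedConst Λ 0 1 * ((∑ m ∈ range n, 4 * (2 * klFlowDeg m + 1) * (1 + 4 * klFlowDeg m) ^ 0 * Q.CL β m) / L)) ^ 2 *
                ((2 / Λ) ^ (2 * 1) * (2 * β / Λ))) +
            ((Ng : ℝ) * s₀ / 4) ^ 4 *
              ((L₂ : ℝ) ^ 2 * ((1 / (β * (L₂ : ℝ) ^ 2)) ^ 4 * (β * (L₂ : ℝ) ^ 2) ^ 2 * (2 * Real.pi / β) ^ 4 *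
                  (uvMixedConst Λ 2 1 * ((∑ m ∈ range n, 4 * (2 * klFlowDeg m + 1) * (1 + 4 * klFlowDeg m) ^ 0 * Q.CL β m) / L)) ^ 2 *
                    (4 ^ 4 * ((2 / Λ) ^ (2 * 4 - 2) * (2 * β / Λ)) + 4 * (2 : ℕ) * (2 / Λ) ^ (2 * 4))) +
                4 * ((L₂ : ℝ) ^ 2 * (4 * ((1 / (β * (L₂ : ℝ) ^ 2)) ^ 2 * ((β * (L₂ : ℝ) ^ 2) *
                  (uvMixedConst Λ 0 1 * ((∑ m ∈ range n, 4 * (2 * klFlowDeg m + 1) * (1 + 4 * klFlowDeg m) ^ 0 * Q.CL β m) / L) *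
                    (β / (Real.pi * (2 * Mc - 3))) ^ 2)))) ^ 2)) +
            2 * (((L₂ : ℝ) / 4) ^ 4 *
              ((L₂ : ℝ) ^ 2 * ((1 / (β * (L₂ : ℝ) ^ 2)) ^ 4 * (β * (L₂ : ℝ) ^ 2) ^ 2 * (2 * Real.pi / L₂) ^ 4 *
                (uvMixedConst Λ 0 3 * (2 / Λ) ^ 2 * (7 : ℝ) ^ 2 *
                    ((∑ m ∈ range n, 4 * (2 * klFlowDeg m + 1) * (1 + 4 * klFlowDeg m) ^ 0 * Q.CL β m) / L) +
                  uvMixedConst Λ 0 2 * (2 / Λ) *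
                    ((7 : ℝ) * ((∑ m ∈ range n, 4 * (2 * klFlowDeg m + 1) * (1 + 4 * klFlowDeg m) ^ 0 * Q.CL β m) / L) +
                      2 * 7 * ((∑ m ∈ range n, 4 * (2 * klFlowDeg m + 1) * (1 + 4 * klFlowDeg m) ^ 1 * Q.CL β m) / L)) +
                  uvMixedConst Λ 0 1 * ((∑ m ∈ range n, 4 * (2 * klFlowDeg m + 1) * (1 + 4 * klFlowDeg m) ^ 2 * Q.CL β m) / L)) ^ 2 *
                  ((2 / Λ) ^ (2 * 1) * (2 * β / Λ))))))) :=
  rowSum_gridSub_hubbardCovAboveCT_sub_le hβ hΛ (by norm_num) (sum_klFlowDeg_rate_div_nonneg hμ hT hL hM₁ hM₂ hn 0)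
    (sum_klFlowDeg_rate_div_nonneg hμ hT hL hM₁ hM₂ hn 1) (uvLineBound_klFlowFrameU_of_towerV17F2 hμ hT hL hM₁ hn)
    (uvLineBound_klFlowFrameU_of_towerV17F2 hμ hT (hL.trans hLL') hM'₁ hn)
    (lineDiff_klFlowFrameU_of_towerV17F2 hμ hT hL hLL' hM₁ hM₂ hM'₁ hM'₂ hn) hMc hMN hs₀ X

/-- **COLUMN SUMS OF THE TWO-VOLUME FRAME DEFECT, FROM THE TOWER** (same bound). -/
theorem colSum_frameDefect_le_of_towerV17F2 (hμ : μ ∈ klWindowC) (hβ : 0 < β)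
    (hT : TowerP klPredsV17F2 G P Q R β U μ K₀ Lstar Mstar)
    {L : ℕ} [NeZero L] (hL : Lstar ≤ L) {L' : ℕ} [NeZero L'] (hLL' : L ≤ L')
    {M : ℕ} [NeZero M] (hM₁ : Mstar L ≤ M) (hM₂ : Q.M0 β L ≤ M) {M' : ℕ} [NeZero M'] (hM'₁ : Mstar L' ≤ M') (hM'₂ : Q.M0 β L' ≤ M')
    {n : ℕ} (hn : n ≤ nScales β + 1) {Λ : ℝ} (hΛ : 0 < Λ)
    {L₂ Mc Ng : ℕ} [NeZero L₂] [NeZero Ng] (hMc : 2 ≤ Mc) (hMN : 2 * Mc ≤ Ng) {s₀ : ℝ} (hs₀ : 0 < s₀) (Y : GridLeg (GridPoint L₂ Ng)) :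
    ∑ X : GridLeg (GridPoint L₂ Ng),
        ‖((hubbardGridSub L₂ Mc β Ng).transpose * hubbardCovAboveCT L₂ Mc β μ 0 (klFlowFrameU L M β U μ n) Λ * hubbardGridSub L₂ Mc β Ng -
            (hubbardGridSub L₂ Mc β Ng).transpose * hubbardCovAboveCT L₂ Mc β μ 0 (klFlowFrameU L' M' β U μ n) Λ * hubbardGridSub L₂ Mc β Ng) X Y‖ ≤
      Real.sqrt ((2 + 12 / s₀) * 14 ^ 2) *
        Real.sqrt ((Ng : ℝ) ^ 1 * (L₂ : ℝ) ^ 2 *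
          ((L₂ : ℝ) ^ 2 * ((1 / (β * (L₂ : ℝ) ^ 2)) ^ 4 * (β * (L₂ : ℝ) ^ 2) ^ 2 *
              (uvMixedConst Λ 0 1 * ((∑ m ∈ range n, 4 * (2 * klFlowDeg m + 1) * (1 + 4 * klFlowDeg m) ^ 0 * Q.CL β m) / L)) ^ 2 *
                ((2 / Λ) ^ (2 * 1) * (2 * β / Λ))) +
            ((Ng : ℝ) * s₀ / 4) ^ 4 *
              ((L₂ : ℝ) ^ 2 * ((1 / (β * (L₂ : ℝ) ^ 2)) ^ 4 * (β * (L₂ : ℝ) ^ 2) ^ 2 * (2 * Real.pi / β) ^ 4 *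
                  (uvMixedConst Λ 2 1 * ((∑ m ∈ range n, 4 * (2 * klFlowDeg m + 1) * (1 + 4 * klFlowDeg m) ^ 0 * Q.CL β m) / L)) ^ 2 *
                    (4 ^ 4 * ((2 / Λ) ^ (2 * 4 - 2) * (2 * β / Λ)) + 4 * (2 : ℕ) * (2 / Λ) ^ (2 * 4))) +
                4 * ((L₂ : ℝ) ^ 2 * (4 * ((1 / (β * (L₂ : ℝ) ^ 2)) ^ 2 * ((β * (L₂ : ℝ) ^ 2) *
                  (uvMixedConst Λ 0 1 * ((∑ m ∈ range n, 4 * (2 * klFlowDeg m + 1) * (1 + 4 * klFlowDeg m) ^ 0 * Q.CL β m) / L) *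
                    (β / (Real.pi * (2 * Mc - 3))) ^ 2)))) ^ 2)) +
            2 * (((L₂ : ℝ) / 4) ^ 4 *
              ((L₂ : ℝ) ^ 2 * ((1 / (β * (L₂ : ℝ) ^ 2)) ^ 4 * (β * (L₂ : ℝ) ^ 2) ^ 2 * (2 * Real.pi / L₂) ^ 4 *
                (uvMixedConst Λ 0 3 * (2 / Λ) ^ 2 * (7 : ℝ) ^ 2 *
                    ((∑ m ∈ range n, 4 * (2 * klFlowDeg m + 1) * (1 + 4 * klFlowDeg m) ^ 0 * Q.CL β m) / L) +
                  uvMixedConst Λ 0 2 * (2 / Λ) *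
                    ((7 : ℝ) * ((∑ m ∈ range n, 4 * (2 * klFlowDeg m + 1) * (1 + 4 * klFlowDeg m) ^ 0 * Q.CL β m) / L) +
                      2 * 7 * ((∑ m ∈ range n, 4 * (2 * klFlowDeg m + 1) * (1 + 4 * klFlowDeg m) ^ 1 * Q.CL β m) / L)) +
                  uvMixedConst Λ 0 1 * ((∑ m ∈ range n, 4 * (2 * klFlowDeg m + 1) * (1 + 4 * klFlowDeg m) ^ 2 * Q.CL β m) / L)) ^ 2 *
                  ((2 / Λ) ^ (2 * 1) * (2 * β / Λ))))))) :=
  colSum_gridSub_hubbardCovAboveCT_sub_le hβ hΛ (by norm_num) (sum_klFlowDeg_rate_div_nonneg hμ hT hL hM₁ hM₂ hn 0)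
    (sum_klFlowDeg_rate_div_nonneg hμ hT hL hM₁ hM₂ hn 1) (uvLineBound_klFlowFrameU_of_towerV17F2 hμ hT hL hM₁ hn)
    (uvLineBound_klFlowFrameU_of_towerV17F2 hμ hT (hL.trans hLL') hM'₁ hn)
    (lineDiff_klFlowFrameU_of_towerV17F2 hμ hT hL hLL' hM₁ hM₂ hM'₁ hM'₂ hn) hMc hMN hs₀ Y

/-- **ENTRY SUP OF THE TWO-VOLUME FRAME DEFECT, FROM THE TOWER**: `‖D X Y‖ ≤ L₂²·(βL₂²)⁻²·βL₂²·C_{0,1}·(c_0(n)/L)·2β/Λ` for all grid legs `X, Y`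
(uniform in the cutoff of the grid; needs only `sup|K_n^{(L,M)} − K_n^{(L′,M′)}| ≤ c_0(n)/L`). -/
theorem norm_frameDefect_apply_le_of_towerV17F2 (hμ : μ ∈ klWindowC) (hβ : 0 < β) (hT : TowerP klPredsV17F2 G P Q R β U μ K₀ Lstar Mstar)
    {L : ℕ} [NeZero L] (hL : Lstar ≤ L) {L' : ℕ} [NeZero L'] (hLL' : L ≤ L')
    {M : ℕ} [NeZero M] (hM₁ : Mstar L ≤ M) (hM₂ : Q.M0 β L ≤ M) {M' : ℕ} [NeZero M'] (hM'₁ : Mstar L' ≤ M') (hM'₂ : Q.M0 β L' ≤ M')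
    {n : ℕ} (hn : n ≤ nScales β + 1) {Λ : ℝ} (hΛ : 0 < Λ)
    {L₂ Mc Ng : ℕ} [NeZero L₂] [NeZero Ng] (hMN : 2 * Mc ≤ Ng) (X Y : GridLeg (GridPoint L₂ Ng)) :
    ‖((hubbardGridSub L₂ Mc β Ng).transpose * hubbardCovAboveCT L₂ Mc β μ 0 (klFlowFrameU L M β U μ n) Λ * hubbardGridSub L₂ Mc β Ng -
        (hubbardGridSub L₂ Mc β Ng).transpose * hubbardCovAboveCT L₂ Mc β μ 0 (klFlowFrameU L' M' β U μ n) Λ * hubbardGridSub L₂ Mc β Ng) X Y‖ ≤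
      (L₂ : ℝ) ^ 2 * ((1 / (β * (L₂ : ℝ) ^ 2)) ^ 2 * (β * (L₂ : ℝ) ^ 2) *
        (uvMixedConst Λ 0 1 * ((∑ m ∈ range n, Q.CL β m) / L)) * ((2 / Λ) ^ (2 * 0) * (2 * β / Λ))) :=
  norm_gridSub_hubbardCovAboveCT_sub_apply_le hβ hΛ
    (fun k => flowFrames_twoVolume_of_towerV17F2 hμ hT hL hLL' hM₁ hM₂ hM'₁ hM'₂ hn (latticeMomentum L₂ k)) hMN X Y

end Tower

/-! ## §5 History level (inside the engine child's (E3f-F) STEP(n), r2d-p1's `hist`/`hC`/`hrates` binders): the same bracket from rates `a_m/L₁` -/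

section Hist

variable {hist : (L' M' : ℕ) → [NeZero L'] → [NeZero M'] → ℕ → Prop} {β U μ : ℝ}

/-- **The band-difference datum at scale `n` from the rates below `n`** (history level): readings `C⁴` through `hC`, `hist` below `n` in both volumes,
rates `a_m/L₁` ⇒ along every lattice line `K_n^{(L₁,M₁)} − K_n^{(L₂,M₂)}` has value / first / second derivative
`≤ (Σ_{m<n} 4(2d_m+1)(1+4d_m)^j a_m)/L₁`, `j = 0, 1, 2` (`coeffNorm_fsub_klFlowFrameU_le_of_rates_hist` + §1). -/
theorem lineDiff_klFlowFrameU_of_rates_hist {L₁ M₁ L₂ M₂ : ℕ} [NeZero L₁] [NeZero M₁] [NeZero L₂] [NeZero M₂] (hμ : μ ∈ klWindowC)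
    (hC : ∀ (L' M' : ℕ) [NeZero L'] [NeZero M'] (j : ℕ), hist L' M' j →
      ContDiff ℝ 4 (fun θ : ℝ => klLocalPart L' M' β U μ (klFlowFrameU L' M' β U μ j) j θ))
    {n : ℕ} {a : ℕ → ℝ} (h₁ : ∀ j < n, hist L₁ M₁ j) (h₂ : ∀ j < n, hist L₂ M₂ j)
    (hrates : ∀ m < n, ∀ θ : ℝ, |klLocalPart L₁ M₁ β U μ (klFlowFrameU L₁ M₁ β U μ m) m θ -
      klLocalPart L₂ M₂ β U μ (klFlowFrameU L₂ M₂ β U μ m) m θ| ≤ a m / L₁) :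
    ∀ (p : Fin 2 → ℝ) (l : Fin 2), ∃ d' d'' : ℝ → ℝ,
      (∀ t, HasDerivAt (fun t => (klFlowFrameU L₁ M₁ β U μ n).eval (p + t • Pi.single l 1) -
        (klFlowFrameU L₂ M₂ β U μ n).eval (p + t • Pi.single l 1)) (d' t) t) ∧
        (∀ t, HasDerivAt d' (d'' t) t) ∧
          ∀ t, |(klFlowFrameU L₁ M₁ β U μ n).eval (p + t • Pi.single l 1) - (klFlowFrameU L₂ M₂ β U μ n).eval (p + t • Pi.single l 1)| ≤
              (∑ m ∈ range n, 4 * (2 * klFlowDeg m + 1) * (1 + 4 * klFlowDeg m) ^ 0 * a m) / L₁ ∧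
            |d' t| ≤ (∑ m ∈ range n, 4 * (2 * klFlowDeg m + 1) * (1 + 4 * klFlowDeg m) ^ 1 * a m) / L₁ ∧
            |d'' t| ≤ (∑ m ∈ range n, 4 * (2 * klFlowDeg m + 1) * (1 + 4 * klFlowDeg m) ^ 2 * a m) / L₁ :=
  lineDiff_of_coeffNorm_le _ _ (coeffNorm_fsub_klFlowFrameU_le_of_rates_hist hμ hC h₁ h₂ hrates 0)
    (coeffNorm_fsub_klFlowFrameU_le_of_rates_hist hμ hC h₁ h₂ hrates 1) (coeffNorm_fsub_klFlowFrameU_le_of_rates_hist hμ hC h₁ h₂ hrates 2)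

/-- **ROW SUMS OF THE TWO-VOLUME FRAME DEFECT, HISTORY LEVEL** (for `hstep n`): with both flow frames admissible lattice-line bands
(`UVLineBound μ K_n^{(Lᵢ,Mᵢ)} D`, e.g. `D = 7` from `FrameOK` by `uvLineBound_of_frameOK`), `hist`/`hC`/`hrates` as in r2d-p1's doors with
NONNEGATIVE rates, a scale `Λ > 0` and any grid `(L₃, Mc, Ng)` (`2 ≤ Mc`, `2Mc ≤ Ng`, `s₀ > 0`): the two-frame decay constant at
`εⱼ = (Σ_{m<n} 4(2d_m+1)(1+4d_m)^j a_m)/L₁`. -/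
theorem rowSum_frameDefect_le_of_rates_hist {L₁ M₁ L₂ M₂ : ℕ} [NeZero L₁] [NeZero M₁] [NeZero L₂] [NeZero M₂] (hμ : μ ∈ klWindowC) (hβ : 0 < β)
    (hC : ∀ (L' M' : ℕ) [NeZero L'] [NeZero M'] (j : ℕ), hist L' M' j →
      ContDiff ℝ 4 (fun θ : ℝ => klLocalPart L' M' β U μ (klFlowFrameU L' M' β U μ j) j θ))
    {n : ℕ} {a : ℕ → ℝ} (ha : ∀ m < n, 0 ≤ a m) (h₁ : ∀ j < n, hist L₁ M₁ j) (h₂ : ∀ j < n, hist L₂ M₂ j)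
    (hrates : ∀ m < n, ∀ θ : ℝ, |klLocalPart L₁ M₁ β U μ (klFlowFrameU L₁ M₁ β U μ m) m θ -
      klLocalPart L₂ M₂ β U μ (klFlowFrameU L₂ M₂ β U μ m) m θ| ≤ a m / L₁)
    {D : ℝ} (hD : 0 ≤ D) (hK₁ : UVLineBound μ (klFlowFrameU L₁ M₁ β U μ n) D) (hK₂ : UVLineBound μ (klFlowFrameU L₂ M₂ β U μ n) D)
    {Λ : ℝ} (hΛ : 0 < Λ) {L₃ Mc Ng : ℕ} [NeZero L₃] [NeZero Ng] (hMc : 2 ≤ Mc) (hMN : 2 * Mc ≤ Ng) {s₀ : ℝ} (hs₀ : 0 < s₀)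
    (X : GridLeg (GridPoint L₃ Ng)) :
    ∑ Y : GridLeg (GridPoint L₃ Ng),
        ‖((hubbardGridSub L₃ Mc β Ng).transpose * hubbardCovAboveCT L₃ Mc β μ 0 (klFlowFrameU L₁ M₁ β U μ n) Λ * hubbardGridSub L₃ Mc β Ng -
            (hubbardGridSub L₃ Mc β Ng).transpose * hubbardCovAboveCT L₃ Mc β μ 0 (klFlowFrameU L₂ M₂ β U μ n) Λ * hubbardGridSub L₃ Mc β Ng) X Y‖ ≤
      Real.sqrt ((2 + 12 / s₀) * 14 ^ 2) *
        Real.sqrt ((Ng : ℝ) ^ 1 * (L₃ : ℝ) ^ 2 *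
          ((L₃ : ℝ) ^ 2 * ((1 / (β * (L₃ : ℝ) ^ 2)) ^ 4 * (β * (L₃ : ℝ) ^ 2) ^ 2 *
              (uvMixedConst Λ 0 1 * ((∑ m ∈ range n, 4 * (2 * klFlowDeg m + 1) * (1 + 4 * klFlowDeg m) ^ 0 * a m) / L₁)) ^ 2 *
                ((2 / Λ) ^ (2 * 1) * (2 * β / Λ))) +
            ((Ng : ℝ) * s₀ / 4) ^ 4 *
              ((L₃ : ℝ) ^ 2 * ((1 / (β * (L₃ : ℝ) ^ 2)) ^ 4 * (β * (L₃ : ℝ) ^ 2) ^ 2 * (2 * Real.pi / β) ^ 4 *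
                  (uvMixedConst Λ 2 1 * ((∑ m ∈ range n, 4 * (2 * klFlowDeg m + 1) * (1 + 4 * klFlowDeg m) ^ 0 * a m) / L₁)) ^ 2 *
                    (4 ^ 4 * ((2 / Λ) ^ (2 * 4 - 2) * (2 * β / Λ)) + 4 * (2 : ℕ) * (2 / Λ) ^ (2 * 4))) +
                4 * ((L₃ : ℝ) ^ 2 * (4 * ((1 / (β * (L₃ : ℝ) ^ 2)) ^ 2 * ((β * (L₃ : ℝ) ^ 2) *
                  (uvMixedConst Λ 0 1 * ((∑ m ∈ range n, 4 * (2 * klFlowDeg m + 1) * (1 + 4 * klFlowDeg m) ^ 0 * a m) / L₁) *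
                    (β / (Real.pi * (2 * Mc - 3))) ^ 2)))) ^ 2)) +
            2 * (((L₃ : ℝ) / 4) ^ 4 *
              ((L₃ : ℝ) ^ 2 * ((1 / (β * (L₃ : ℝ) ^ 2)) ^ 4 * (β * (L₃ : ℝ) ^ 2) ^ 2 * (2 * Real.pi / L₃) ^ 4 *
                (uvMixedConst Λ 0 3 * (2 / Λ) ^ 2 * D ^ 2 *
                    ((∑ m ∈ range n, 4 * (2 * klFlowDeg m + 1) * (1 + 4 * klFlowDeg m) ^ 0 * a m) / L₁) +
                  uvMixedConst Λ 0 2 * (2 / Λ) *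
                    (D * ((∑ m ∈ range n, 4 * (2 * klFlowDeg m + 1) * (1 + 4 * klFlowDeg m) ^ 0 * a m) / L₁) +
                      2 * D * ((∑ m ∈ range n, 4 * (2 * klFlowDeg m + 1) * (1 + 4 * klFlowDeg m) ^ 1 * a m) / L₁)) +
                  uvMixedConst Λ 0 1 * ((∑ m ∈ range n, 4 * (2 * klFlowDeg m + 1) * (1 + 4 * klFlowDeg m) ^ 2 * a m) / L₁)) ^ 2 *
                  ((2 / Λ) ^ (2 * 1) * (2 * β / Λ))))))) := by
  have hL₁ : (0 : ℝ) < L₁ := by exact_mod_cast Nat.pos_of_ne_zero (NeZero.ne L₁)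
  have hnn : ∀ j : ℕ, 0 ≤ (∑ m ∈ range n, 4 * (2 * (klFlowDeg m : ℝ) + 1) * (1 + 4 * (klFlowDeg m : ℝ)) ^ j * a m) / L₁ := fun j =>
    div_nonneg (sum_nonneg fun m hm => by have := ha m (mem_range.mp hm); positivity) hL₁.le
  exact rowSum_gridSub_hubbardCovAboveCT_sub_le hβ hΛ hD (hnn 0) (hnn 1) hK₁ hK₂ (lineDiff_klFlowFrameU_of_rates_hist hμ hC h₁ h₂ hrates)
    hMc hMN hs₀ X

end Hist

/-! ## §6 Two CONSECUTIVE flow frames of one volume: `K_n ⊖ K_{n+1}` is the scale-`n` piece coefficient-wise -/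

section Consecutive

variable {G : GeoConsts} {P : SplitConsts} {Q : EngConsts} {R : RenConsts} {β U μ : ℝ} {K₀ : TrigPolyC4v} {Lstar : ℕ} {Mstar : ℕ → ℕ}

/-- `coeffExt (K_n ⊖ K_{n+1}) = coeffExt (klFlowPiece n)` (`K_{n+1} = K_n ⊖ piece_n`). -/
theorem coeffExt_fsub_klFlowFrameU_succ {L M : ℕ} [NeZero L] [NeZero M] (β U μ : ℝ) (n m' n' : ℕ) :
    coeffExt (fsub (klFlowFrameU L M β U μ n) (klFlowFrameU L M β U μ (n + 1))) m' n' = coeffExt (klFlowPiece L M β U μ n) m' n' := by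
  rw [coeffExt_fsub, klFlowFrameU_succ, coeffExt_fsub]; ring

/-- **The frame SHIFT `K_n ⊖ K_{n+1}` in every coefficient weight, from the tower**: `coeffNorm r (K_n^{(L,M)} ⊖ K_{n+1}^{(L,M)}) ≤ 4(2d_n+1)(1+4d_n)^r·R.cr|U|Λ_n²/e₀`
(`n ≤ nScales β`; the pinned-currency twin of the value-level frame-shift response `…EngineFrameShiftResponse`: with §1 and the Literature layer, the
cross-frame covariance defect `Sᵀ(C^{K_n}_{>Λ} − C^{K_{n+1}}_{>Λ})S` of ONE volume has row/column sums and entries `O(4^{(2r−2)n}·|U|)`-small). -/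
theorem coeffNorm_fsub_klFlowFrameU_succ_le_of_towerV17F2 (hμ : μ ∈ klWindowC) (hT : TowerP klPredsV17F2 G P Q R β U μ K₀ Lstar Mstar)
    {L : ℕ} [NeZero L] (hL : Lstar ≤ L) {M : ℕ} [NeZero M] (hM : Mstar L ≤ M) {n : ℕ} (hn : n ≤ nScales β) (r : ℕ) :
    (fsub (klFlowFrameU L M β U μ n) (klFlowFrameU L M β U μ (n + 1))).coeffNorm r ≤
      4 * (2 * klFlowDeg n + 1) * (1 + 4 * klFlowDeg n) ^ r * (R.cr * |U| * klScale klE0 n ^ 2 / klE0) := by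
  have hTL := hT L M hL hM
  have hren : RenormFlowAtV17F L M β U μ R n := (hTL.1 n hn).1
  have htwo : TwoLegStepV17F2 L M G P Q R β U μ n := (hTL.1 n hn).2.2.2
  set A := fsub (klFlowFrameU L M β U μ n) (klFlowFrameU L M β U μ (n + 1)) with hA
  have hPD : (klFlowPiece L M β U μ n).degree ≤ A.degree := by
    rw [hA, klFlowFrameU_succ]
    exact le_trans (le_max_right _ _) (le_max_right _ _)
  rw [coeffNorm_eq_sum_coeffExt A le_rfl r]
  simp_rw [hA, coeffExt_fsub_klFlowFrameU_succ]
  rw [← coeffNorm_eq_sum_coeffExt (klFlowPiece L M β U μ n) hPD r]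
  exact coeffNorm_klFlowPieceJackson_le hμ n htwo.1.1 hren.1 r

end Consecutive

end Summit.HubbardSuperconductivity.HubbardSuperconductivity.Theorems.TwoPointAssembly

end
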